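import Summits.ResolutionOfSingularities.ResolutionOfSingularities.Theorems.WeightedInvariantIota3LemmaCPrimeVanishing
import Mathlib.Data.Nat.Choose.Lucas
import Mathlib.Data.Nat.Factorization.Basic
import HarnessLib

/-!
# LEMMA C′ in iterated-polynomial form, III: the HASSE-DERIVATIVE STEP (`r₂ ∤ r₁`, some `λ_c ≠ 0` with `p ∤ c`)
# (door `HypersurfaceCentreConstruction`, stmt-ResolutionOfSingularities-19897; proof of LEMMA C′, memo RESIDUE-PLAN.md §3b)

Helper for `stub_keyRungGrHomLE_three` (def-free, `--supports 19897`).  In `κ[X][V][Y]` (set-up of …Iota3LemmaCPrimeVanishing):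
`choose_ordProj_ne_zero` (Lucas: `(ν choose q) ≠ 0` in `κ` for `q = p^{v_p(ν)}`, `p` the characteristic, `q = 1` in characteristic
`0`), `hasseDeriv_taylor'`/`hasseDeriv_map'` (Hasse derivatives commute with the functional-equation substitution), `coeff_hasseDeriv_pure`
(the Hasse derivative `D^{(q)}P` of a pure `P` is pure of degree `ν − q`), and **`tau_eq_zero_of_not_frobenius`**: if `r₂ ∤ r₁` and NOT
(`p` prime and every `λ_c ≠ 0` has `p ∣ c`), then `τ = 0` — either `λ_0 = 0` (vanishing lemma directly) or `λ_0 ≠ 0`, and then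
`D^{(q)}P` (`q = p^{v_p(ν)}`) is pure with top coefficient `(ν choose q) λ_ν ≠ 0`, satisfies the same functional equation, and has
`λ'_0 = λ_q = 0` (as `r₂ ∤ r₁ q`), so the vanishing lemma applies to it.  Also `eq_C_mul_X_pow_of_lam_eq_zero` (`λ_c = 0` for `c < ν`
means `P = λ_ν Y^ν`).
[OURS · L1 W4.3 · (o70-b)/(Δ12); AI work, weaker than expert review; nothing here is a statement of the manuscript under review.]
-/

noncomputable section

open Polynomial

set_option linter.dupNamespace false -- mandated namespace of this single-conjunct summit

namespace Summit.ResolutionOfSingularities.ResolutionOfSingularities.Cruxes.HypersurfaceCentreConstruction.LocalEngine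

namespace Iota3

namespace LemmaCPrime

variable {κ : Type} [Field κ]

/-- **Lucas**: for `q = p^{v_p(ν)}` (`p` the characteristic of the field `κ`; `q = 1` in characteristic `0`) and `ν ≥ 1`,
the binomial coefficient `ν choose q` is non-zero in `κ`. [folklore] -/
theorem choose_ordProj_ne_zero {ν : ℕ} (hν : 1 ≤ ν) :
    ((ν.choose (ringChar κ ^ ν.factorization (ringChar κ)) : ℕ) : κ) ≠ 0 := by
  rcases CharP.char_is_prime_or_zero κ (ringChar κ) with hp | hp
  · haveI := Fact.mk hp
    set p := ringChar κ with hpdef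
    have hν0 : ν ≠ 0 := by omega
    have hdecomp : p ^ ν.factorization p * (ν / p ^ ν.factorization p) = ν := Nat.ordProj_mul_ordCompl_eq_self ν p
    have hcop : ¬ p ∣ ν / p ^ ν.factorization p := by
      have h := Nat.coprime_ordCompl hp hν0
      exact (Nat.Prime.coprime_iff_not_dvd hp).mp h
    have hmod : (p ^ ν.factorization p * (ν / p ^ ν.factorization p)).choose (p ^ ν.factorization p * 1) ≡
        (ν / p ^ ν.factorization p).choose 1 [MOD p] := Choose.choose_pow_mul_pow_mul_modEq_choose_nat
    rw [mul_one, hdecomp, Nat.choose_one_right] at hmod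
    intro h0
    rw [CharP.cast_eq_zero_iff κ p] at h0
    exact hcop ((Nat.ModEq.dvd_iff hmod (dvd_refl p)).mp h0)
  · haveI : CharP κ 0 := hp ▸ ringChar.charP κ
    haveI := CharP.charP_to_charZero κ
    rw [hp, Nat.factorization_zero_right, pow_zero, Nat.choose_one_right]
    exact_mod_cast (show ν ≠ 0 by omega)

/-- Hasse derivatives commute with the Taylor shift. [folklore] -/
theorem hasseDeriv_taylor' {R : Type} [CommRing R] (r : R) (f : R[X]) (k : ℕ) :
    hasseDeriv k (taylor r f) = taylor r (hasseDeriv k f) := by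
  ext n
  have hc := congrArg (fun φ : R[X] →ₗ[R] R[X] => φ f) (hasseDeriv_comp (R := R) n k)
  simp only [LinearMap.comp_apply, LinearMap.smul_apply] at hc
  rw [hasseDeriv_coeff, taylor_coeff, taylor_coeff, hc, eval_smul, nsmul_eq_mul, Nat.choose_symm_add]

/-- Hasse derivatives commute with extension of scalars. [folklore] -/
theorem hasseDeriv_map' {R S : Type} [CommRing R] [CommRing S] (φ : R →+* S) (k : ℕ) (f : R[X]) :
    hasseDeriv k (f.map φ) = (hasseDeriv k f).map φ := by
  ext n
  simp only [hasseDeriv_coeff, coeff_map, map_mul, map_natCast]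

/-- **The Hasse derivative of a pure polynomial is pure**: `coeff_c (D^{(q)} P) = ((c+q) choose q) λ_{c+q} V^{e_{c+q}}`. [folklore] -/
theorem coeff_hasseDeriv_pure {lam : ℕ → κ} {ex : ℕ → ℕ} {P : κ[X][X][X]}
    (hP : ∀ c, P.coeff c = monomial (ex c) (C (lam c))) (q c : ℕ) :
    (hasseDeriv q P).coeff c = monomial (ex (c + q)) (C (((c + q).choose q : κ) * lam (c + q))) := by
  rw [hasseDeriv_coeff, hP (c + q), ← nsmul_eq_mul, ← nsmul_eq_mul, map_nsmul, map_nsmul]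

/-- For a pure `P` with `λ_0 ≠ 0`: `λ_c ≠ 0` forces `r₂ ∣ r₁ c`. [folklore] -/
theorem dvd_mul_of_lam_ne_zero {r₁ r₂ ν : ℕ} {lam : ℕ → κ} {ex : ℕ → ℕ}
    (hex : ∀ c, lam c ≠ 0 → c ≤ ν ∧ r₂ * ex c = r₁ * (ν - c)) (h0 : lam 0 ≠ 0) {c : ℕ} (hc : lam c ≠ 0) :
    r₂ ∣ r₁ * c := by
  obtain ⟨_, he0⟩ := hex 0 h0
  obtain ⟨hcν, hec⟩ := hex c hc
  rw [Nat.sub_zero] at he0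
  have h1 : r₂ ∣ r₁ * ν := ⟨ex 0, he0.symm⟩
  have h2 : r₂ ∣ r₁ * (ν - c) := ⟨ex c, hec.symm⟩
  have h3 : r₁ * c = r₁ * ν - r₁ * (ν - c) := by
    rw [Nat.mul_sub, Nat.sub_sub_self (Nat.mul_le_mul_left r₁ hcν)]
  rw [h3]
  exact Nat.dvd_sub h1 h2

/-- **A pure `P` with `λ_c = 0` for all `c < ν` is `λ_ν Y^ν`.** [folklore] -/
theorem eq_C_mul_X_pow_of_lam_eq_zero {r₁ r₂ ν : ℕ} (hr₂ : 0 < r₂) {lam : ℕ → κ} {ex : ℕ → ℕ} {P : κ[X][X][X]}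
    (hP : ∀ c, P.coeff c = monomial (ex c) (C (lam c))) (hex : ∀ c, lam c ≠ 0 → c ≤ ν ∧ r₂ * ex c = r₁ * (ν - c))
    (hν : lam ν ≠ 0) (hzero : ∀ c, c < ν → lam c = 0) : P = C (C (C (lam ν))) * X ^ ν := by
  refine Polynomial.ext fun c => ?_
  rw [hP c, coeff_C_mul_X_pow]
  split_ifs with hc
  · obtain ⟨_, he⟩ := hex ν hν
    rw [Nat.sub_self, mul_zero] at he
    have heν : ex ν = 0 := (Nat.mul_eq_zero.mp he).resolve_left (by omega)
    rw [hc, heν, monomial_zero_left]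
  · rcases lt_or_gt_of_ne hc with hlt | hgt
    · rw [hzero c hlt, map_zero, map_zero]
    · have : lam c = 0 := by
        by_contra h; exact absurd (hex c h).1 (not_le.mpr hgt)
      rw [this, map_zero, map_zero]

/-- **THE HASSE-DERIVATIVE STEP.**  For a pure `P = Σ_c λ_c V^{e_c} Y^c` (`λ_ν ≠ 0`, `ν ≥ 1`) with the functional equation
`P(V, Y) = P(V + εX^j, Y + τ)` and `r₂ ∤ r₁`: unless (`p = char κ` is prime and every `λ_c ≠ 0` has `p ∣ c`), `τ = 0`.
(If `λ_0 = 0` this is the vanishing lemma; otherwise apply it to `D^{(q)} P`, `q = p^{v_p(ν)}`, whose top coefficient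
`(ν choose q) λ_ν` is non-zero by Lucas and whose bottom coefficient `λ_q` vanishes because `r₂ ∤ r₁ q`.)
[OURS · L1 W4.3 · (o70-b)/(Δ12)] -/
theorem tau_eq_zero_of_not_frobenius {r₁ r₂ ν : ℕ} (hr₂ : 0 < r₂) (hν1 : 1 ≤ ν) (hndvd : ¬ r₂ ∣ r₁)
    {lam : ℕ → κ} {ex : ℕ → ℕ} {P : κ[X][X][X]} (hP : ∀ c, P.coeff c = monomial (ex c) (C (lam c)))
    (hex : ∀ c, lam c ≠ 0 → c ≤ ν ∧ r₂ * ex c = r₁ * (ν - c)) (hν : lam ν ≠ 0)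
    {ε : κ} (hε : ε ≠ 0) {j : ℕ} {τ : κ[X][X]} (hfe : P = taylor τ (P.map (taylorAlgHom (C ε * X ^ j)).toRingHom))
    (hB1 : ¬ ((ringChar κ).Prime ∧ ∀ c, lam c ≠ 0 → ringChar κ ∣ c)) : τ = 0 := by
  classical
  by_cases h0 : lam 0 = 0
  · exact tau_eq_zero_of_lam_zero hr₂ hP hex hν h0 hε hfe (Or.inl hndvd)
  set p := ringChar κ with hpdef
  set q := p ^ ν.factorization p with hqdef
  -- `r₂ ∤ r₁ q`
  have hq3 : ¬ r₂ ∣ r₁ * q := by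
    rcases CharP.char_is_prime_or_zero κ p with hp | hp
    · have hc₁ : ∃ c₁, lam c₁ ≠ 0 ∧ ¬ p ∣ c₁ := by
        by_contra hall
        push Not at hall
        exact hB1 ⟨hp, hall⟩
      obtain ⟨c₁, hl₁, hpc₁⟩ := hc₁
      intro hdq
      have hdc := dvd_mul_of_lam_ne_zero hex h0 hl₁
      have hcop : Nat.Coprime q c₁ := Nat.Coprime.pow_left _ ((Nat.Prime.coprime_iff_not_dvd hp).mpr hpc₁)
      have hg := Nat.dvd_gcd hdq hdc
      rw [Nat.gcd_mul_left, Nat.Coprime.gcd_eq_one hcop, mul_one] at hg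
      exact hndvd hg
    · rw [hqdef, hp, Nat.factorization_zero_right, pow_zero, mul_one]; exact hndvd
  have hqν : q ∣ ν := Nat.ordProj_dvd ν p
  -- `λ_q = 0` and `q < ν`
  have hlamq : lam q = 0 := by
    by_contra h; exact hq3 (dvd_mul_of_lam_ne_zero hex h0 h)
  have hqlt : q < ν := by
    rcases (Nat.le_of_dvd (by omega) hqν).lt_or_eq with h | h
    · exact h
    · exact absurd (h ▸ hlamq) hν
  -- the Hasse derivative `D^{(q)} P` is pure of degree `ν − q`, with `λ'_0 = λ_q = 0` and `λ'_{ν−q} = (ν choose q) λ_ν ≠ 0`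
  set P' := hasseDeriv q P with hP'def
  have hP' : ∀ c, P'.coeff c = monomial (ex (c + q)) (C (((c + q).choose q : κ) * lam (c + q))) :=
    fun c => coeff_hasseDeriv_pure hP q c
  have hex' : ∀ c, ((c + q).choose q : κ) * lam (c + q) ≠ 0 → c ≤ ν - q ∧ r₂ * ex (c + q) = r₁ * (ν - q - c) := by
    intro c hc
    have hl : lam (c + q) ≠ 0 := fun h => hc (by rw [h, mul_zero])
    obtain ⟨h1, h2⟩ := hex (c + q) hl
    refine ⟨by omega, ?_⟩
    rw [h2]; congr 1; omega
  have hν' : ((ν - q + q).choose q : κ) * lam (ν - q + q) ≠ 0 := by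
    rw [Nat.sub_add_cancel hqlt.le]
    exact mul_ne_zero (choose_ordProj_ne_zero hν1) hν
  have h0' : ((0 + q).choose q : κ) * lam (0 + q) = 0 := by rw [zero_add, hlamq, mul_zero]
  have hfe' : P' = taylor τ (P'.map (taylorAlgHom (C ε * X ^ j)).toRingHom) := by
    rw [hP'def, ← hasseDeriv_map', ← hasseDeriv_taylor', ← hfe]
  exact tau_eq_zero_of_lam_zero (ν := ν - q) (lam := fun c => ((c + q).choose q : κ) * lam (c + q))
    (ex := fun c => ex (c + q)) hr₂ hP' hex' hν' h0' hε hfe' (Or.inl hndvd)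

end LemmaCPrime

end Iota3

end Summit.ResolutionOfSingularities.ResolutionOfSingularities.Cruxes.HypersurfaceCentreConstruction.LocalEngine

end
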